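import Summits.ResolutionOfSingularities.ResolutionOfSingularities.Theorems.MarkedTransferCampaignW46LooseExitTree
import Summits.ResolutionOfSingularities.ResolutionOfSingularities.Theorems.MarkedTransferCampaignW46AdmissibleDivision
import Summits.ResolutionOfSingularities.ResolutionOfSingularities.Theorems.MarkedTransferCampaignW46ThreadChainDivisors
import Summits.ResolutionOfSingularities.ResolutionOfSingularities.Theorems.MarkedTransferCampaignW46ThreadChainStep
import HarnessLib

/-!
# [OURS · L1 W4.6 rung (i-b)] The normal form of the controlled transform at a point over an isolated node is the LOOSE
# transform (the exceptional curve is the only curve of the singular locus through the new point)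
# (cell res-hironaka, LADDER-RESOLUTION rung L, D-0089; campaign s46, prover res-L1-s46-pv-1; host route MarkedTransfer,
# `--supports stmt-ResolutionOfSingularities-16155`)

HONEST FRAMING. Nothing here is a statement of H. Hironaka's manuscript (2017-03-23, [Hironaka2017]); pure commutative
algebra inside a field `K` (loose exit tree `…LooseExitTree.lean`, normal forms `…AdmissibleDivision.lean`, prime divisors
`…ThreadChainDivisors.lean`, the one-step calculus `…ThreadChainStep.lean`). AI-written; weaker than expert review. No
`sorry`; axioms standard.

## What

Let `⟨S, J⟩` be an ISOLATED node (`J ⊆ 𝔪^b`, `J ⊄ (q^b)` for every prime `q`) and `S'` a two-dimensional first quadratic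
transform of `S` with chart element `x`. The controlled transform `H = (J S' : x^b)` (the stalk right after the point blow-up)
is `x^{m-b} · L` with `L = (J S' : x^m)` the loose transform, `m = b·⌊ord J/b⌋`; its admissible divisors are the powers
`x^{bc}`, `bc ≤ m - b`, up to units — a regular-parameter prime `σ ≁ x` with `H ⊆ (σ^b)` would contract to a prime `π₁` of
`S` with `J ⊆ (π₁^b)` (`le_span_pow_of_extIdeal_le`, the centre of the prime divisor `S'_{(σ)}` on `S`). Hence
**`normalForm b H = L`** (`normalForm_ctrlTransform_eq_looseTransform`): after the point blow-up, the forced blow-ups of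
the exceptional curve are exactly the admissible divisions available, and they end at the loose transform.

## References

* O. Zariski, P. Samuel, *Commutative Algebra* II (1960), Appendix 5. [ZariskiSamuel1960]
-/

noncomputable section

open IsLocalRing

-- single-problem summit: the doubled namespace component `ResolutionOfSingularities` is forced
set_option linter.dupNamespace false

namespace Summit.ResolutionOfSingularities.ResolutionOfSingularities.Theorems.CampaignW46

open Literature.AlgebraicGeometry.Resolution

universe u

variable {K : Type u} [Field K]

/-! ## Divisibility read in a prime divisor -/

section PrimeDivisor

variable {S : Subring K} {π : S}

/-- **`y/π^n ∈ S_{(π)}` implies `π^n ∣ y`** (for `y ∈ S`, `π` prime). [folklore] -/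
theorem pow_dvd_of_div_pow_mem_ofPrime (hπ : Prime π) (y : S) (n : ℕ)
    (h : haveI := isPrime_span_of_prime hπ;
      (y : K) / (π : K) ^ n ∈ (LocalSubring.ofPrime S (Ideal.span {π})).toSubring) : π ^ n ∣ y := by
  haveI := isPrime_span_of_prime hπ
  have hπ0 : (π : K) ≠ 0 := fun e => hπ.ne_zero (Subtype.ext e)
  obtain ⟨a, s, hs, he⟩ := mem_ofPrime_iff.mp h
  have hs0 : (s : K) ≠ 0 := coe_ne_zero_of_not_mem (K := K) hs
  have hys : y * s = π ^ n * a := by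
    apply Subtype.ext
    simp only [Subring.coe_mul, SubmonoidClass.coe_pow]
    rw [div_eq_div_iff (pow_ne_zero n hπ0) hs0] at he
    linear_combination he
  have hdvd : π ^ n ∣ y * s := ⟨a, hys⟩
  have hns : ¬ π ∣ s := fun h => hs (Ideal.mem_span_singleton.mpr h)
  exact hπ.pow_dvd_of_dvd_mul_right n hns hdvd

end PrimeDivisor

/-! ## The centre on `S` of a prime of `S'` containing `J S'` to the power `b` -/

/-- **Contraction of a `b`-th power divisibility.** Let `S ⊆ S' ⊆ K = Frac S`, `S` a two-dimensional regular local ring,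
`σ` a prime element of `S'` not dividing some `x ∈ 𝔪_S`, and `J S' ⊆ (σ^b)`. Then `J ⊆ (π₁^b)` for a prime element `π₁`
of `S` (the centre of the prime divisor `S'_{(σ)}` on `S`, which equals `S_{(π₁)}`). [cite: ZariskiSamuel1960, Appendix 5] -/
theorem exists_prime_le_span_pow_of_extIdeal_le {S S' : Subring K} [IsRegularLocalRing S] (hdim : ringKrullDim S = 2)
    (hS : ∀ z : K, ∃ a ∈ S, ∃ c ∈ S, c ≠ 0 ∧ z = a / c) (hle : S ≤ S') {σ : S'} (hσ : Prime σ)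
    {x : S} (hxm : x ∈ maximalIdeal S) (hx : ¬ σ ∣ Subring.inclusion hle x) {J : Ideal S} {b : ℕ}
    (hJ : extIdeal J S' ≤ Ideal.span {σ ^ b}) : ∃ π₁ : S, Prime π₁ ∧ J ≤ Ideal.span {π₁ ^ b} := by
  obtain ⟨π₁, hπ₁, -, hW⟩ := exists_prime_span_eq_comap hdim hS hle hσ hxm hx
  haveI := isPrime_span_of_prime hπ₁
  haveI := isPrime_span_of_prime hσ
  set W₁ := (LocalSubring.ofPrime S (Ideal.span {π₁})).toSubring with hW₁
  set W₂ := (LocalSubring.ofPrime S' (Ideal.span {σ})).toSubring with hW₂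
  have heq : W₂ = W₁ := eq_of_ofPrime_span_le hπ₁ hS hW (inv_not_mem_ofPrime_span hσ)
  -- `σ = π₁ w` with `w ∈ W₁`
  have hσW : (σ : K) ∈ W₁ := heq ▸ LocalSubring.le_ofPrime _ _ σ.2
  have hσiW : (σ : K)⁻¹ ∉ W₁ := heq ▸ inv_not_mem_ofPrime_span hσ
  obtain ⟨w, hw, hσw⟩ := exists_eq_mul_of_inv_not_mem_ofPrime (P := Ideal.span {π₁}) rfl hσW hσiW
  refine ⟨π₁, hπ₁, fun f hf => ?_⟩
  rw [Ideal.mem_span_singleton]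
  apply pow_dvd_of_div_pow_mem_ofPrime hπ₁ f b
  -- `f = σ^b g` in `S'`
  have hfext : Subring.inclusion hle f ∈ extIdeal J S' := by
    rw [extIdeal_eq_map _ hle]; exact Ideal.mem_map_of_mem _ hf
  obtain ⟨g, hg⟩ := Ideal.mem_span_singleton'.mp (hJ hfext)
  have hfK : (f : K) = (σ : K) ^ b * (g : K) := by
    have := congrArg Subtype.val hg
    simp only [Subring.coe_mul, SubmonoidClass.coe_pow] at this
    have e2 : ((Subring.inclusion hle f : S') : K) = (f : K) := rfl
    rw [e2] at this
    rw [← this]; ring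
  have hπ0 : (π₁ : K) ≠ 0 := fun e => hπ₁.ne_zero (Subtype.ext e)
  have hval : (f : K) / (π₁ : K) ^ b = w ^ b * (g : K) := by
    rw [hfK, hσw, mul_pow, div_eq_iff (pow_ne_zero b hπ0)]; ring
  have hgW : (g : K) ∈ W₁ := by rw [← heq]; exact LocalSubring.le_ofPrime _ _ g.2
  rw [hval]
  exact Subring.mul_mem _ (Subring.pow_mem _ hw b) hgW

/-! ## Products of associates of a prime -/

/-- A product `∏_{σ ∈ s} σ^b` all of whose factors are associated to `x` is a unit times `x^{b·|s|}`. [folklore] -/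
theorem exists_unit_mul_pow_of_forall_dvd {D : Type*} [CommRing D] [IsDomain D] {x : D} (hx : Prime x) (b : ℕ) :
    ∀ s : Multiset D, (∀ σ ∈ s, Prime σ ∧ σ ∣ x) →
      ∃ u : Dˣ, (s.map (· ^ b)).prod = (u : D) * x ^ (b * Multiset.card s) := by
  intro s
  induction s using Multiset.induction with
  | empty => intro _; exact ⟨1, by simp⟩
  | cons σ s ih =>
    intro hs
    obtain ⟨u, hu⟩ := ih fun τ hτ => hs τ (Multiset.mem_cons_of_mem hτ)
    obtain ⟨hσp, hσx⟩ := hs σ (Multiset.mem_cons_self σ s)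
    obtain ⟨v, hv⟩ := hσp.associated_of_dvd hx hσx
    -- `σ v = x`
    refine ⟨(v⁻¹) ^ b * u, ?_⟩
    rw [Multiset.map_cons, Multiset.prod_cons, hu, Multiset.card_cons, ← hv]
    push_cast
    rw [show b * (Multiset.card s + 1) = b + b * Multiset.card s by ring, pow_add, mul_pow]
    have e : (σ : D) ^ b = ((↑v⁻¹ : D) ^ b) * (σ * ↑v) ^ b := by
      rw [mul_pow, ← mul_assoc, mul_comm ((↑v⁻¹ : D) ^ b), mul_assoc, ← mul_pow, Units.inv_mul, one_pow, mul_one]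
    rw [e]; ring

/-! ## The normal form of the controlled transform -/

section Main

variable {b : ℕ} {S S' : Subring K} [IsRegularLocalRing S] [IsRegularLocalRing S'] {J : Ideal S}

/-- A valuation ring of `K` dominating both members of a quadratic transform `S → S'` (Chevalley, through the chain
`S ≤ S' ≤ S' ≤ ⋯`). [cite: ZariskiSamuel1960, Ch. VI §4, Thm. 5] -/
theorem exists_valuationSubring_of_isQuadraticTransform (h₁ : IsQuadraticTransform S S') :
    ∃ O : ValuationSubring K, SubringDominates S O.toSubring ∧ SubringDominates S' O.toSubring := by
  let R : ℕ → Subring K := fun i => if i = 0 then S else S'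
  have hR0 : R 0 = S := by simp [R]
  have hRs : ∀ i, R (i + 1) = S' := fun i => by simp [R]
  have hloc : ∀ i, IsLocalRing ↥(R i) := by
    intro i; cases i with
    | zero => rw [hR0]; infer_instance
    | succ j => rw [hRs]; infer_instance
  have hdom : ∀ i, SubringDominates (R i) (R (i + 1)) := by
    intro i; cases i with
    | zero => rw [hR0, hRs]; exact h₁.dominates
    | succ j => rw [hRs, hRs]; exact SubringDominates.refl _
  obtain ⟨O, hO⟩ := exists_valuationSubring_subringDominates_chain R hloc hdom
  refine ⟨O, ?_, ?_⟩
  · have := hO 0; rwa [hR0] at this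
  · have := hO 1; rwa [hRs] at this

/-- `(a · L : a) = L` in a domain (`a ≠ 0`). [folklore] -/
theorem colon_span_singleton_mul_eq {D : Type*} [CommRing D] [IsDomain D] {a : D} (ha : a ≠ 0) (L : Ideal D) :
    Submodule.colon (Ideal.span {a} * L) (Ideal.span {a}) = L := by
  ext z
  rw [mem_colon_span_singleton_iff]
  constructor
  · intro hz
    obtain ⟨l, hl, he⟩ := Ideal.mem_span_singleton_mul.mp hz
    have : l = z := mul_left_cancel₀ ha (he.trans (mul_comm z a))
    exact this ▸ hl
  · intro hz
    rw [show z * a = a * z from mul_comm z a]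
    exact Ideal.mul_mem_mul (Ideal.mem_span_singleton_self a) hz

/-- **THE NORMAL FORM OF THE CONTROLLED TRANSFORM IS THE LOOSE TRANSFORM.** At a two-dimensional first quadratic
transform `S'` of an isolated node `⟨S, J⟩`: `normalForm b (J S' : x^b) = (J S' : x^m)`, `m = b·⌊ord J/b⌋`.
[cite: ZariskiSamuel1960, Appendix 5] -/
theorem normalForm_ctrlTransform_eq_looseTransform (hn : IsIsolatedNode b (⟨S, J⟩ : MarkedNode K))
    (h₁ : IsQuadraticTransform S S') (hd' : ringKrullDim S' = 2) :
    normalForm b (ctrlTransform b S J S') = looseTransform b S J S' := by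
  classical
  obtain ⟨⟨_, hdim, hof, hJb⟩, hiso, -⟩ := id hn
  have hb : 0 < b := hn.b_pos
  have hJ0 : J ≠ ⊥ := hn.ne_bot
  have hle : S ≤ S' := h₁.dominates.1
  -- exponents
  set r := exactOrder S J with hr
  set m := looseExponent b S J with hmdef
  have hJr : J ≤ maximalIdeal S ^ r := le_pow_exactOrder J
  have hJr1 : ¬ J ≤ maximalIdeal S ^ (r + 1) := not_le_pow_exactOrder_succ hJ0
  have hbr : b ≤ r := hn.le_exactOrder
  have hbm : b ≤ m := le_looseExponent hb hbr
  have hmr : m ≤ r := looseExponent_le b J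
  have hrm : r < m + b := exactOrder_lt_looseExponent_add hb J
  have hbdm : b ∣ m := dvd_looseExponent b J
  obtain ⟨q, hq⟩ := hbdm
  have hq1 : 1 ≤ q := by
    by_contra h0; push Not at h0
    have : q = 0 := by omega
    rw [this, mul_zero] at hq; omega
  -- a valuation ring along the step, the chart element
  obtain ⟨O, hSO, hS'O⟩ := exists_valuationSubring_of_isQuadraticTransform h₁
  have hst : IsQuadraticTransformAlong O S S' := h₁.along ⟨inferInstance, IsNoetherian.noetherian _⟩ hS'O
  have hSS' : SubringDominates S S' := h₁.dominates
  obtain ⟨_, x, hxm, hx0, -, hT, -, -⟩ := id h₁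
  have hx0K : (x : K) ≠ 0 := fun e => hx0 (Subtype.ext e)
  have hmax : ∀ y ∈ maximalIdeal S, O.valuation (y : K) ≤ O.valuation (x : K) := by
    intro y hy
    have hyx : (y : K) / (x : K) ∈ O := hS'O.1 (hT (div_mem_blowupRing (x : K) hy))
    rw [← O.valuation_le_one_iff, map_div₀, div_le_one₀ (pos_iff_ne_zero.mpr ((map_ne_zero _).mpr hx0K))] at hyx
    exact hyx
  obtain ⟨hx1, hXp, hX2, -, hXm⟩ := prime_chart_succ hdim hd' hst hSO hxm hx0 hmax
  set X : S' := ⟨(x : K), hx1⟩ with hXdef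
  have hX0 : X ≠ 0 := hXp.ne_zero
  -- `𝔪_S S' = (X)`
  have hmx : extIdeal (maximalIdeal S) S' = Ideal.span {X} := by
    rw [extIdeal_eq_map _ hle]
    apply le_antisymm
    · rw [Ideal.map_le_iff_le_comap]
      intro y hy
      rw [Ideal.mem_comap, Ideal.mem_span_singleton']
      refine ⟨⟨(y : K) / x, hT (div_mem_blowupRing _ hy)⟩, Subtype.ext ?_⟩
      change (y : K) / x * x = y
      rw [div_mul_cancel₀ _ hx0K]
    · rw [Ideal.span_singleton_le_iff_mem]
      exact Ideal.mem_map_of_mem (Subring.inclusion hle) hxm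
  -- product laws: `X^b H = J S' = X^m L`
  set H := ctrlTransform b S J S' with hH
  set L := looseTransform b S J S' with hL
  have hHlaw : Ideal.span {X ^ b} * H = extIdeal J S' := by
    have hsub : extIdeal J S' ≤ Ideal.span {X ^ b} := by
      rw [← Ideal.span_singleton_pow, ← hmx, extIdeal_eq_map _ hle, extIdeal_eq_map _ hle, ← Ideal.map_pow]
      exact Ideal.map_mono hJb
    have h := eq_span_singleton_mul_colon_span hsub
    rw [hH, ctrlTransform, hmx, Ideal.span_singleton_pow]
    exact h.symm
  have hLlaw : Ideal.span {X ^ m} * L = extIdeal J S' := span_pow_mul_looseTransform b hle X hmx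
  have hHL : H = Ideal.span {X ^ (m - b)} * L := by
    apply (Ideal.span_singleton_mul_right_inj (pow_ne_zero b hX0)).mp
    rw [hHlaw, ← hLlaw, ← mul_assoc, Ideal.span_singleton_mul_span_singleton, ← pow_add, Nat.add_sub_cancel' hbm]
  -- `m - b = b (q - 1)`
  have hmb : m - b = b * (q - 1) := by
    rw [hq, Nat.mul_sub, mul_one]
  apply le_antisymm
  · -- `normalForm H ≤ L`
    rw [normalForm_le_iff]
    intro d hd hHd
    obtain ⟨s, hs, rfl⟩ := hd
    -- every factor divides `X`
    have hall : ∀ σ ∈ s, Prime σ ∧ σ ∣ X := by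
      intro σ hσ
      refine ⟨(hs σ hσ).1, ?_⟩
      by_contra hσx
      -- `J S' = X^b H ⊆ (σ^b)` contracts to `J ⊆ (π₁^b)`
      have hσb : extIdeal J S' ≤ Ideal.span {σ ^ b} := by
        rw [← hHlaw]
        refine Ideal.mul_le_left.trans (hHd.trans ?_)
        rw [Ideal.span_singleton_le_span_singleton]
        obtain ⟨s', rfl⟩ := Multiset.exists_cons_of_mem hσ
        rw [Multiset.map_cons, Multiset.prod_cons]
        exact Dvd.intro _ rfl
      obtain ⟨π₁, hπ₁, hJπ⟩ := exists_prime_le_span_pow_of_extIdeal_le hdim hof.2 hle (hs σ hσ).1 hxm hσx hσb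
      exact hiso π₁ hπ₁ hJπ
    obtain ⟨u, hu⟩ := exists_unit_mul_pow_of_forall_dvd hXp b s hall
    set c := Multiset.card s with hc
    -- `b c ≤ m - b`: from the exactness of the order along the chart
    have hbc : b * c + b ≤ r := by
      by_contra hlt
      push Not at hlt
      obtain ⟨z, hzJ, hzr⟩ : ∃ z ∈ J, z ∉ maximalIdeal S ^ (r + 1) := Set.not_subset.mp hJr1
      obtain ⟨y, hm2, -, -⟩ := exists_maximalIdeal_eq_span_pair_of_not_mem_sq hdim hxm
        (IsQuadraticTransform.chart_not_mem_sq hT hSS' hx0)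
      obtain ⟨hw1, hndvd⟩ := div_pow_mem_and_not_dvd hdim hst hSO hm2 hmax (hJr hzJ) hzr
      -- `z = X^b h`, `h ∈ H ⊆ (u X^{bc})`
      have hzext : Subring.inclusion hle z ∈ extIdeal J S' := by
        rw [extIdeal_eq_map _ hle]; exact Ideal.mem_map_of_mem _ hzJ
      rw [← hHlaw] at hzext
      obtain ⟨h, hh, hzh⟩ := Ideal.mem_span_singleton_mul.mp hzext
      obtain ⟨t, ht⟩ := Ideal.mem_span_singleton'.mp (hHd hh)
      -- so `X^{b + bc} ∣ z = X^r w`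
      have hzK : ((Subring.inclusion hle z : S') : K) = (X : K) ^ r * ((z : K) / (x : K) ^ r) := by
        change (z : K) = (x : K) ^ r * ((z : K) / (x : K) ^ r)
        rw [mul_div_cancel₀ _ (pow_ne_zero r hx0K)]
      set w : S' := ⟨(z : K) / (x : K) ^ r, hw1⟩ with hwdef
      have hzw : Subring.inclusion hle z = X ^ r * w := Subtype.ext hzK
      have hdiv : X ^ (b + b * c) ∣ X ^ r * w := by
        rw [← hzw, ← hzh, ← ht, hu]
        exact ⟨t * u, by rw [pow_add]; ring⟩
      have hlt' : r < b + b * c := by omega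
      obtain ⟨e, he⟩ := hdiv
      have hXw : X ∣ w := by
        have h2 : X ^ r * w = X ^ r * (X ^ (b + b * c - r) * e) := by
          rw [he, ← mul_assoc, ← pow_add, Nat.add_sub_cancel' hlt'.le]
        have h3 : w = X ^ (b + b * c - r) * e := mul_left_cancel₀ (pow_ne_zero r hX0) h2
        refine ⟨X ^ (b + b * c - r - 1) * e, ?_⟩
        rw [h3, ← mul_assoc, ← pow_succ', Nat.sub_add_cancel (by omega)]
      exact hndvd hx1 hXw
    have hbcm : b * c ≤ m - b := by
      rw [hmb]
      have : b * c < b * q := by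
        calc b * c < r + 1 - b := by omega
          _ ≤ b * q := by omega
      have hcq : c < q := Nat.lt_of_mul_lt_mul_left this
      exact Nat.mul_le_mul_left b (by omega)
    -- `(H : d) = (H : X^{bc}) ≤ (H : X^{m-b}) = L`
    rw [hu, colon_span_singleton_unit_mul u.isUnit]
    calc Submodule.colon H (Ideal.span {X ^ (b * c)})
        ≤ Submodule.colon H (Ideal.span {X ^ (m - b)}) :=
          Submodule.colon_mono le_rfl (Ideal.span_singleton_le_span_singleton.mpr (pow_dvd_pow X hbcm))
      _ = L := by rw [hHL, colon_span_singleton_mul_eq (pow_ne_zero _ hX0)]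
  · -- `L ≤ normalForm H`: `L = (H : X^{m-b})`, `X^{m-b} = X^{b(q-1)}` admissible
    have hadm : IsAdmissibleDivisor b (X ^ (m - b)) := by
      refine ⟨Multiset.replicate (q - 1) X, fun σ hσ => ?_, ?_⟩
      · rw [Multiset.eq_of_mem_replicate hσ]; exact ⟨hXp, hX2⟩
      · rw [Multiset.map_replicate, Multiset.prod_replicate, ← pow_mul, hmb]
    have hHd : H ≤ Ideal.span {X ^ (m - b)} := by rw [hHL]; exact Ideal.mul_le_right
    have h := colon_le_normalForm hadm hHd
    rwa [hHL, colon_span_singleton_mul_eq (pow_ne_zero _ hX0), ← hHL] at h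

end Main

end Summit.ResolutionOfSingularities.ResolutionOfSingularities.Theorems.CampaignW46

end
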